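import Summits.QuantumFields.YangMills.Theorems.BalabanUVNodesPortHRecordJoinSwap
import Summits.QuantumFields.YangMills.Theorems.BalabanUVNodesPortU8Linearisation
import Literature.MathematicalPhysics.QuantumFieldTheory.Balaban1983to89.B7BlockAvgLog
import Literature.MathematicalPhysics.QuantumFieldTheory.Balaban1983to89.Beta.BackgroundVertices
import Literature.MathematicalPhysics.QuantumFieldTheory.Balaban1983to89.B12ChartGaugeFlow48

/-!
# K0ᴬ — LEAF (B) OF NODE v8 AT THE RECORD, DEFINITIONS: the (4.8) gauge flow `exp(tΛ_λ)` in the record's NAMED gauge group, its flow map on two-block chart inputs,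
# the pure-gauge leg `recordGradLeg λ` (ALL site functions `λ`), and the auxiliary `actU` ∕ `invGauge`

The route-posited objects of ◇ lens-1 g7's record file `nodeO-cover/LENS-1-GaugeFlowRec-v1.lean` (600f5219c8e2c257), custody-cut by ◆ CRIT-1 g35 06:17:16Z (PASS ×3 +
hosting word (a)(b)(c)), landed by porter `ymgap-nodeO-port-PTB-1` g4 as the Defs file of `…/Theorems/BalabanUVNodesK0AxGaugeFlowRec.lean` (the 29+ theorems incl.
★★★ `chartGaugeFlow_record : ChartGaugeFlow (recordAct …) (recordCoords …) (recordChartJ …) recordGradLeg`).  §0 of the HOME file (the row `ChartGaugeFlow`) is DROPPED here —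
it is ✓ `Literature/…/Balaban1983to89/B12ChartGaugeFlow48.lean` (p812753), imported.  NAME RULE O-9: `recordGradLeg` is declared ONCE, here
(`Summit.QuantumFields.YangMills.Theorems.K0AxGaugeFlowRec.recordGradLeg`; ★★ DEF-1 may alias by `abbrev` in a names edition).  `--supports stmt-QuantumFields-27238 --as helper`.
[I] = [Balaban1987RG1].

CONTENTS: `gaugeGen` (Λ_λ(x) = Σ_a λ(x,a) τ_a, traceless), `expGauge` (t ↦ exp(tΛ_λ) ∈ `recordGaugeGrp`, det = 1 by `det exp = exp tr`), `chartPairJ` ∕ `pairCoordsJ` (uncut pair of a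
chart input ∕ a pair read back in two-block coordinates), `gaugeFlowMap` (φ_u = coordinates of `Sect2.cAct u (exp W_U, W_J)`), `recordGradLeg` (λ(b₋) − λ(b₊) on the 𝐔-coordinates,
0 on the 𝐉-coordinates), `actU` (the transformed 𝐔-block), `invGauge` (x ↦ u(x)⁻¹); with their defining bookkeeping lemmas.

HONEST FRAMING.  Record-level definitions and matrix bookkeeping; nothing of Bałaban is asserted, ported or discharged; K0ᴬ `Record13SepCoPHInhabitedAx` (stmt-QuantumFields-27238)
OPEN; NODE O 0∕1; COUNT 8∕28 · K 1∕4 UNMOVED; ONE finite `𝕋⁴_{L^K}` at fixed ε — NOT continuum ∕ OS ∕ Clay; **the Yang–Mills mass gap is NOT proved by any of this.**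
-/

noncomputable section

open scoped BigOperators Matrix.Norms.L2Operator Topology
open Set Filter Metric
open NormedSpace (exp)

namespace Summit.QuantumFields.YangMills.Theorems.K0AxGaugeFlowRec

open Summit.QuantumFields.YangMills.Theorems.K0RecordFormatNames
open Summit.QuantumFields.YangMills.Theorems
open Literature.MathematicalPhysics.QuantumFieldTheory.Balaban1983to89
open Literature.MathematicalPhysics.QuantumFieldTheory.Balaban1983to89.Node00
open Literature.MathematicalPhysics.QuantumFieldTheory.Balaban1983to89.T4Continuum (T4Family)
open Literature.MathematicalPhysics.QuantumFieldTheory.Balaban1983to89.Beta.BackgroundVertices (expUnit val_expUnit val_inv_expUnit)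

variable (F : T4Family)

/-! ## §1  Names: the gauge generator `Λ_λ(x) = Σ_a λ(x,a) τ_a`, the flow `exp(tΛ_λ)` in `recordGaugeGrp`, the flow map on chart inputs, the gradient leg -/

/-- The 𝔰𝔩₂(ℂ)-valued gauge generator of a site function `λ : sites → ℂ³`: `Λ(x) = Σ_a λ(x,a) τ_a`. [cite: Balaban1987RG1, (1.10) p.262, (4.8) p.283] -/
def gaugeGen (K : ℕ) (lam : Site (F.P K) 0 → Fin 3 → ℂ) (x : Site (F.P K) 0) : MatA 2 := ∑ a : Fin 3, lam x a • sl2Gen a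

/-- The gauge generator is traceless (`τ_a ∈ 𝔰𝔩₂(ℂ)`). [cite: Balaban1987RG1, (1.10) p.262 (bookkeeping)] -/
theorem trace_gaugeGen (K : ℕ) (lam : Site (F.P K) 0 → Fin 3 → ℂ) (x : Site (F.P K) 0) : (gaugeGen F K lam x).trace = 0 := by
  simp [gaugeGen, sl2Gen, Matrix.trace_fin_two, Fin.sum_univ_three]

/-- The 𝔰𝔩₂-coordinates of the gauge generator are `λ(x, ·)`. [cite: Balaban1987RG1, (1.10) p.262 (bookkeeping)] -/
theorem sl2Coord_gaugeGen (K : ℕ) (lam : Site (F.P K) 0 → Fin 3 → ℂ) (x : Site (F.P K) 0) (a : Fin 3) :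
    sl2Coord (gaugeGen F K lam x) a = lam x a := by
  fin_cases a <;> simp [sl2Coord, gaugeGen, sl2Gen, Fin.sum_univ_three]

/-- `sl2Coord` of a difference. [folklore] -/
theorem sl2Coord_sub (A B : MatA 2) : sl2Coord (A - B) = sl2Coord A - sl2Coord B := by
  ext a; fin_cases a <;> simp [sl2Coord]; ring

/-- `det exp(tΛ) = exp(t tr Λ) = 1`: the flow lies in `Gᶜ = SL(2, ℂ)`. [cite: Balaban1987RG1, (1.10) p.262] -/
theorem det_exp_smul_gaugeGen (K : ℕ) (lam : Site (F.P K) 0 → Fin 3 → ℂ) (x : Site (F.P K) 0) (z : ℂ) :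
    (exp (z • gaugeGen F K lam x)).det = 1 := by
  rw [Literature.Analysis.Matrix.det_exp_eq_exp_trace, Matrix.trace_smul, trace_gaugeGen, smul_zero, NormedSpace.exp_zero]

/-- **The (4.8) gauge flow `t ↦ exp(tΛ_λ)`** as a one-parameter family in the record's NAMED gauge group `recordGaugeGrp F K` (`Gᶜ = SL(2,ℂ)`-valued site functions).
[cite: Balaban1987RG1, (4.8) p.283, (1.10) p.262] -/
def expGauge (K : ℕ) (lam : Site (F.P K) 0 → Fin 3 → ℂ) (t : ℝ) : recordGaugeGrp F K :=
  ⟨fun x => expUnit ℂ ((t : ℂ) • gaugeGen F K lam x), fun x => by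
    rw [B12RegularSpaces111SpecialUnitary.mem_suModel_Gc, val_expUnit]; exact det_exp_smul_gaugeGen F K lam x _⟩

/-- The flow's value at a site as a matrix: `exp(t·Λ_λ(x))`. [cite: Balaban1987RG1, (4.8) p.283 (bookkeeping)] -/
@[simp] theorem coe_expGauge (K : ℕ) (lam : Site (F.P K) 0 → Fin 3 → ℂ) (t : ℝ) (x : Site (F.P K) 0) :
    ((expGauge F K lam t).1 x : MatA 2) = exp ((t : ℂ) • gaugeGen F K lam x) := rfl

/-- The inverse of the flow's value at a site as a matrix: `exp(−t·Λ_λ(x))`. [cite: Balaban1987RG1, (4.8) p.283 (bookkeeping)] -/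
@[simp] theorem coe_inv_expGauge (K : ℕ) (lam : Site (F.P K) 0 → Fin 3 → ℂ) (t : ℝ) (x : Site (F.P K) 0) :
    (((expGauge F K lam t).1 x)⁻¹ : (MatA 2)ˣ) = (exp (-((t : ℂ) • gaugeGen F K lam x)) : MatA 2) := rfl

/-- The UNCUT pair charted by a chart input: `(exp W_U(b), W_J(b))` on EVERY fine bond. [cite: Balaban1987RG1, (1.9) p.261, p.258] -/
def chartPairJ (K : ℕ) (w : Fin (recordChartDimJ F K) → ℂ) : Sect2.CPair (F.P K) (MatA 2) :=
  (fun b => exp (chartMatU F K w b), fun b => chartMatJc F K w b)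

/-- A pair `(𝐔, 𝐉)` read back in two-block chart coordinates: `(sl2Coord (log 𝐔(b)), sl2Coord 𝐉(b))` (the series logarithm near `1`; the same words as
`recordEmbL` ∕ `recordEmbLocξ`). [cite: Balaban1987RG1, (1.9) p.261, p.258, (4.8) p.283 («(1∕i) log V^v»)] -/
def pairCoordsJ (K : ℕ) (φ : Sect2.CPair (F.P K) (MatA 2)) : Fin (recordChartDimJ F K) → ℂ :=
  fun i => Sum.elim (fun a => sl2Coord (MatrixLog.mlog (φ.1 ((chartEquivJ F K).symm i).1)) a)
    (fun a => sl2Coord (φ.2 ((chartEquivJ F K).symm i).1) a) ((chartEquivJ F K).symm i).2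

/-- **The flow map on chart inputs** `φ_u(w)` := the chart coordinates of `(𝐔, 𝐉)^u` for `(𝐔, 𝐉) = (exp W_U, W_J)`:
`(sl2Coord log(u₋ e^{W_U(b)} u₊⁻¹), sl2Coord (u₋ W_J(b) u₋⁻¹))`. [cite: Balaban1987RG1, (4.8) p.283, (1.10) p.262] -/
def gaugeFlowMap (K : ℕ) (u : recordGaugeGrp F K) (w : Fin (recordChartDimJ F K) → ℂ) : Fin (recordChartDimJ F K) → ℂ :=
  pairCoordsJ F K (Sect2.cAct u.1 (chartPairJ F K w))

/-- **`recordGradLeg F K λ`** — THE PURE-GAUGE LEG: the lattice gradient `λ(b₋) − λ(b₊)` (𝔰𝔩₂-coordinatewise) on the `𝐔`-coordinates, `0` on the `𝐉`-coordinates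
(the velocity at the FLAT chart origin `(𝐔, 𝐉) = (1, 0)` of the orbit under `exp(tΛ_λ)`; print's `−∂λ`). Over ALL site functions `λ`. [cite: Balaban1987RG1, (4.8) p.283, (4.15) p.284] -/
def recordGradLeg (K : ℕ) (lam : Site (F.P K) 0 → Fin 3 → ℂ) : Fin (recordChartDimJ F K) → ℂ :=
  fun i => Sum.elim (fun a => lam ((chartEquivJ F K).symm i).1.src a - lam ((chartEquivJ F K).symm i).1.tgt a) (fun _ => 0)
    ((chartEquivJ F K).symm i).2

/-- The gauge-transformed `𝐔`-block of the charted pair. [cite: Balaban1987RG1, (1.10) p.262] -/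
def actU (K : ℕ) (u : recordGaugeGrp F K) (w : Fin (recordChartDimJ F K) → ℂ) (b : PBond (F.P K) 0) : MatA 2 :=
  (u.1 b.src : MatA 2) * exp (chartMatU F K w b) * ((u.1 b.tgt)⁻¹ : (MatA 2)ˣ)

/-- The inverse of a `Gᶜ = SL(2,ℂ)`-valued gauge transformation has determinant `1` at every site. [cite: Balaban1987RG1, (1.10) p.262 (bookkeeping)] -/
theorem det_coe_inv (K : ℕ) (u : recordGaugeGrp F K) (x : Site (F.P K) 0) : (((u.1 x)⁻¹ : (MatA 2)ˣ) : MatA 2).det = 1 := by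
  have h2 : ((u.1 x : (MatA 2)ˣ) : MatA 2).det = 1 := B12RegularSpaces111SpecialUnitary.mem_suModel_Gc.1 (u.2 x)
  have h := congrArg Matrix.det (Units.mul_inv (u.1 x))
  rw [Matrix.det_mul, h2, one_mul, Matrix.det_one] at h
  exact h

/-- The inverse transformation `x ↦ u(x)⁻¹` in the record's gauge group. [cite: Balaban1987RG1, (1.10) p.262] -/
def invGauge (K : ℕ) (u : recordGaugeGrp F K) : recordGaugeGrp F K :=
  ⟨fun x => (u.1 x)⁻¹, fun x => by rw [B12RegularSpaces111SpecialUnitary.mem_suModel_Gc]; exact det_coe_inv F K u x⟩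

end Summit.QuantumFields.YangMills.Theorems.K0AxGaugeFlowRec

end
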